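/-
Copyright: H21 programme, solo seat `solo-RiemannHypothesis-informed` (session 4).
-/
import Summits.RiemannHypothesis.RiemannHypothesis.Theorems.SoloInformedDoubleLogWindow
import Summits.RiemannHypothesis.RiemannHypothesis.Theorems.SoloInformedPlateau
import Literature.NumberTheory.LFunctions.ZetaZerosReflection

/-!
# Double-log visibility, parameter-free form (solo-informed, T18)

The explicit-window theorem (T17) with the concrete bump `ψ₁(s) = ST(1 − s)·ST(1 + s)`
(`windowPlateau 1`, T14) and the reflection `ρ ↦ 1 − ρ̄` (so the offset may be taken positive):
for every `η ≠ 0`, `|η| < ½` there is `c₀(η) ≥ 0` such that for `|γ₀| ≥ 1` and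
`c ≥ c₀(η) + log log(|γ₀| + 2)/(2|η|)`, a zero `½ + η + iγ₀` together with local RH of radius
`R`, `R² ≥ e^{c+1}`, near `γ₀` forces `ε(c+1) < 0`
(`weilGroundEnergy_neg_of_local_doubleLog_offset`).

This is the sharpest form landed of the statement "RH fails visibly at the double-logarithmic
scale of the height of an off-line zero — granted RH locally in a poly-logarithmic window around
it"; without the local hypothesis only the single-log scale `a ≍ log|γ₀|` is available (T10).
-/

open MeasureTheory Complex Set Filter Topology Literature.NumberTheory.LFunctions
open scoped ContDiff ComplexConjugate

namespace Summit.RiemannHypothesis.RiemannHypothesis.Theorems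

/-! ## A concrete bump: `ψ₁ = b_1 = ST(1 − s)·ST(1 + s)` -/

/-- The concrete bump `ψ₁(s) = ST(1 − s) ST(1 + s)` has `Φ(θ) > 0` for every `θ`. -/
theorem bumpLaplace_windowPlateau_one_pos (θ : ℝ) : 0 < bumpLaplace (windowPlateau 1) θ := by
  unfold bumpLaplace
  refine Continuous.integral_pos_of_hasCompactSupport_nonneg_nonzero (x := 0)
    ((continuous_windowPlateau 1).mul (by fun_prop)) ((hasCompactSupport_windowPlateau 1).mul_right)
    (fun s ↦ mul_nonneg (windowPlateau_nonneg 1 s) (Real.exp_nonneg _)) ?_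
  rw [windowPlateau_eq_one (by simp), mul_zero, Real.exp_zero, mul_one]
  exact one_ne_zero

/-! ## Reflection: the offset may be taken positive -/

/-- If `ζ(½ + η + iγ₀) = 0` with `|η| < ½` then `ζ(½ − η + iγ₀) = 0` (`ρ ↦ 1 − ρ̄`). -/
theorem riemannZeta_zero_reflect {η γ₀ : ℝ} (hη : |η| < 1 / 2)
    (hζ : riemannZeta (1 / 2 + η + γ₀ * I) = 0) : riemannZeta (1 / 2 - η + γ₀ * I) = 0 := by
  have hlt := abs_lt.mp hη
  have hre : (1 / 2 + η + γ₀ * I : ℂ).re = 1 / 2 + η := by simp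
  have hre' : (1 / 2 - η + γ₀ * I : ℂ).re = 1 / 2 - η := by simp
  have h0 : 0 < (1 / 2 + η + γ₀ * I : ℂ).re := by rw [hre]; linarith
  have h1 : (1 / 2 + η + γ₀ * I : ℂ).re < 1 := by rw [hre]; linarith
  have hne : (1 / 2 + η + γ₀ * I : ℂ) ≠ 1 := by
    intro h; have := congrArg Complex.re h; rw [hre] at this; simp at this; linarith
  have hne' : (1 / 2 - η + γ₀ * I : ℂ) ≠ 1 := by
    intro h; have := congrArg Complex.re h; rw [hre'] at this; simp at this; linarith
  have hm := (riemannZetaZeroOrder_pos_iff hne).mpr hζ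
  rw [← riemannZetaZeroOrder_one_sub_conj h0 h1] at hm
  have e : (1 - conj (1 / 2 + η + γ₀ * I) : ℂ) = 1 / 2 - η + γ₀ * I := by
    apply Complex.ext
    · simp; ring
    · simp
  rw [e] at hm
  exact (riemannZetaZeroOrder_pos_iff hne').mp hm

/-! ## The main statement -/

/-- **Double-log visibility of a fixed-offset zero (T18, parameter-free form).** For every offset
`η ≠ 0`, `|η| < ½` there is `c₀ = c₀(η) ≥ 0` such that for all `|γ₀| ≥ 1` and all
`c ≥ c₀ + log log(|γ₀| + 2) / (2|η|)`: if `ζ(½ + η + iγ₀) = 0` and RH holds locally near `γ₀`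
— every zero `ρ` with `0 ≤ Re ρ ≤ 1`, `|Im ρ − γ₀| < R` is on the critical line or is one of
`½ ± |η| + iγ₀` — for some radius `R ≥ 1` with `R² ≥ e^{c+1}`, then the Weil form has a
negative direction supported in `[−(c+1), c+1]`: `ε(c+1) < 0`.
(`ψ = ψ₁ = ST(1−s)ST(1+s)`; T17 + reflection.) -/
theorem weilGroundEnergy_neg_of_local_doubleLog_offset {η : ℝ} (hη0 : η ≠ 0) (hη : |η| < 1 / 2) :
    ∃ c₀ : ℝ, 0 ≤ c₀ ∧ ∀ (γ₀ c R : ℝ), 1 ≤ |γ₀| →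
      c₀ + Real.log (Real.log (|γ₀| + 2)) / (2 * |η|) ≤ c → 1 ≤ R → Real.exp (c + 1) ≤ R ^ 2 →
      riemannZeta (1 / 2 + η + γ₀ * I) = 0 →
      (∀ ρ : ℂ, riemannZeta ρ = 0 → 0 ≤ ρ.re → ρ.re ≤ 1 → |ρ.im - γ₀| < R → ρ.re ≠ 1 / 2 →
          ρ = 1 / 2 + ↑|η| + γ₀ * I ∨ ρ = 1 / 2 - ↑|η| + γ₀ * I) →
      weilGroundEnergy (c + 1) < 0 := by
  have hpos : 0 < |η| := abs_pos.mpr hη0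
  obtain ⟨c₀, hc₀, hT⟩ := weilGroundEnergy_neg_of_local_doubleLog (ψ := windowPlateau 1)
    (contDiff_windowPlateau 1) (tsupport_windowPlateau_subset 1) (windowPlateau_nonneg 1) hpos hη
    (bumpLaplace_windowPlateau_one_pos |η|)
  refine ⟨c₀, hc₀, fun γ₀ c R hγ hc hR hRa hζ hloc ↦ hT γ₀ c R hγ hc hR hRa ?_ hloc⟩
  rcases le_or_gt 0 η with h | h
  · rw [abs_of_nonneg h]; exact hζ
  · rw [abs_of_neg h]
    push_cast
    rw [show (1 / 2 + -(η : ℂ) + γ₀ * I) = 1 / 2 - η + γ₀ * I by ring]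
    exact riemannZeta_zero_reflect hη hζ

end Summit.RiemannHypothesis.RiemannHypothesis.Theorems
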